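import Summits.Schanuel.Schanuel.Theorems.ZilberEacPolynomialPower
import Summits.Schanuel.Schanuel.Theorems.ZilberEacEquivariantDirectionDensity
import Summits.Schanuel.Schanuel.Theorems.ZilberEacInvariantDirectionGeneric
import HarnessLib

/-!
# Equivariant bases with RATIONAL drift (no rotation): Zariski density via THEOREM M₂; hence
# EVERY real drift coefficient in the slow regime (O53 (b), part)

Zilber's Exponential-Algebraic Closedness, case ladder (host summit Schanuel, cell `pub-schanuel`,
seat 2, gen 12).  `ZilberEacEquivariantDirectionDensity` proves density over a base
`g(x + zq) = g(x) + βz` when the drift `β` is IRRATIONAL (the power coordinate rotates; THEOREM M).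
For RATIONAL `β = k/N` the phase `e^{2πiβm}` is periodic: along the arithmetic progression `m = Nm'`
it is `1`, the power coordinate is `e^{g(r(m))} m^{βλ}` WITHOUT rotation, and THEOREM M₂
(`ZilberEacPolynomialPower`) eliminates as soon as the limit family `{(e^{g(r_p)}, r_p)}` is generic —
which `invariantDirection_limits_generic` (gen 11) supplies from ONE transversal lattice ray with
`Re g_D(2πiℓ₀) ≠ 0`.

* `unprojectedDense_polyFibredGraph_equivariantDirection_of_generic` (`Nβ ∈ ℤ`, generic limits);
* `unprojectedDense_polyFibredGraph_equivariantDirection_rat` (`Nβ ∈ ℤ`, a transversal ray);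
* **`unprojectedDense_polyFibredGraph_equivariantDirection_real`** — EVERY real `β`: equivariant
  base of degree `≥ 1`, a transversal lattice direction `ℓ₀` (all `ℓ₀ⱼ ≠ 0`, `Re g_D(2πiℓ₀) ≠ 0`),
  targets `(Aⱼ)_{dⱼ}(2πiq) ≠ 0` with `dⱼ = λqⱼ`, fibres in the slow regime
  `βλ + max(βλ,0) deg fⱼ < dⱼ` ⟹ `I(W ∩ Γ_exp) = I(W)` (irrational `β`: THEOREM M; rational: M₂);
* members (`polyFibredGraph_equivariantDirection_real_member_dense`) and the example
  **`negSqDiffQuarter_member_dense`**: `{x₂ = -(x₀ - x₁)² + x₀/4, y₀ = x₀ + y₂, y₁ = x₁ + y₂}` —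
  rational drift `1/4`, degenerate balance direction, not invariant, no negative ray — certified
  member of `EC(3,2)`, not linearly split, meets `Γ_exp`, DENSE.

HONEST FRAMING: explicit families inside an OPEN cell; the literal O53 (b) example
`x₂ = -(x₀-x₁)² + x₀` (`β = 1`: critical size `βλ = d`) is NOT in the slow regime and stays open;
`EC(3,2)` OPEN; NOT Schanuel's conjecture; EAC ⇏ SC.
-/

noncomputable section

open Complex MvPolynomial Filter Topology
open Literature.NumberTheory.Transcendental Literature.ModelTheory.Zilber
  Literature.ModelTheory.ExponentialFields

set_option linter.dupNamespace false

namespace Summit.Schanuel.Schanuel.Theorems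

/-! ## Part A. Rational drift: density from a generic limit family (THEOREM M₂) -/

section Rational

variable {s : ℕ}

/-- **Density over an equivariant base with drift `β`, `Nβ ∈ ℤ`, from a GENERIC limit family.**
Along `m = N m'` the labelled solutions of `exists_solutions_equivariantDirection` have power
coordinate `e^{g(r(m))} m^{βλ}` (no rotation); THEOREM M₂ with the genericity of
`{(e^{g(r_p)}, r_p)}`. (new) [cite: MantovaMasser2023, §1 p.5 (the open case dim π(V) = 2 in ℂ³×ℂˣ³)] -/
theorem unprojectedDense_polyFibredGraph_equivariantDirection_of_generic
    (g : MvPolynomial (Fin (s + 1)) ℂ) (q : Fin (s + 1) → ℤ) (β : ℝ) (N : ℕ) (hN : 0 < N) (k : ℤ)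
    (hβN : (N : ℝ) * β = k)
    (hequiv : ∀ (x : Fin (s + 1) → ℂ) (z : ℂ),
      eval (x + z • fun j => (q j : ℂ)) g = eval x g + (β : ℂ) * z)
    (A : Fin (s + 1) → MvPolynomial (Fin (s + 1)) ℂ)
    (hA : ∀ j, eval (fun i => 2 * Real.pi * I * (q i : ℂ))
      (homogeneousComponent (A j).totalDegree (A j)) ≠ 0)
    (lam : ℝ) (hlam : ∀ j, ((A j).totalDegree : ℝ) = lam * (q j : ℝ)) (f : Fin (s + 1) → Polynomial ℂ)
    (hslow : ∀ j, β * lam + max (β * lam) 0 * ((f j).natDegree : ℝ) < (A j).totalDegree)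
    (hgen : ∀ G : MvPolynomial (Fin (s + 2)) ℂ, G ≠ 0 → ∃ p : Fin (s + 1) → ℤ,
      eval (Fin.cons (exp (eval (fun j => 2 * Real.pi * I * (p j : ℂ) +
          log (eval (fun i => 2 * Real.pi * I * (q i : ℂ))
            (homogeneousComponent (A j).totalDegree (A j)))) g))
        (fun j => 2 * Real.pi * I * (p j : ℂ) +
          log (eval (fun i => 2 * Real.pi * I * (q i : ℂ))
            (homogeneousComponent (A j).totalDegree (A j)))) : Fin (s + 2) → ℂ) G ≠ 0) :
    UnprojectedDense (polyFibredGraph g A (fun j => (f j).toMvPolynomial 0)) := by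
  classical
  set Llog : Fin (s + 1) → ℂ := fun j => log (eval (fun i => 2 * Real.pi * I * (q i : ℂ))
    (homogeneousComponent (A j).totalDegree (A j))) with hLlog
  have hβC : (N : ℂ) * (β : ℂ) = (k : ℂ) := by
    have h := congrArg (fun x : ℝ => (x : ℂ)) hβN
    push_cast at h
    exact h
  -- the arithmetic progression `m = N m'`
  have hmul : Tendsto (fun m' : ℕ => N * m') atTop atTop :=
    Filter.tendsto_atTop_atTop.2 fun b => ⟨b, fun m hm => hm.trans (Nat.le_mul_of_pos_left _ hN)⟩
  refine unprojectedDense_of_polynomial_power (t := s + 1)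
    (isIrreducibleClosed_polyFibredGraph g A _) (by rw [zariskiDim_polyFibredGraph])
    (fun i => Sum.inl (Fin.castSucc i)) (Sum.inr (Fin.last (s + 1)))
    (fun j => (lam : ℂ) * (q j : ℂ)) (fun j => (q j : ℂ)) (β * lam) Complex.two_pi_I_ne_zero
    (fun ρ => exp (eval ρ g))
    (U := {ρ | ∃ p : Fin (s + 1) → ℤ, ρ = fun j => 2 * Real.pi * I * (p j : ℂ) + Llog j})
    (fun G hG => ?_) ?_
  · obtain ⟨p, hp⟩ := hgen G hG
    exact ⟨_, ⟨p, rfl⟩, hp⟩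
  rintro ρ₀ ⟨p, rfl⟩
  obtain ⟨x, r, hsol, hx, hgx, hr⟩ :=
    exists_solutions_equivariantDirection g q β hequiv A hA lam hlam f hslow p
  set P : ℕ → Fin (s + 2) ⊕ Fin (s + 2) → ℂ := fun m' =>
    pgParam g A (fun j => (f j).toMvPolynomial 0) (x (N * m')) (exp (eval (x (N * m')) g)) with hP
  have hexpm : ∀ m' : ℕ, 1 ≤ m' → exp (((Real.log ((N * m' : ℕ) : ℝ) : ℝ)) : ℂ) = ((N * m' : ℕ) : ℂ) := by
    intro m' hm
    have hpos : (0 : ℝ) < ((N * m' : ℕ) : ℝ) := by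
      have : 0 < N * m' := Nat.mul_pos hN hm
      exact_mod_cast this
    rw [← Complex.ofReal_exp, Real.exp_log hpos]
    push_cast
    rfl
  -- the rational phase is trivial along the progression
  have hone : ∀ m' : ℕ, exp ((β : ℂ) * (2 * Real.pi * I * ((N * m' : ℕ) : ℂ))) = 1 := by
    intro m'
    have e : (β : ℂ) * (2 * Real.pi * I * ((N * m' : ℕ) : ℂ)) = ((k * (m' : ℤ) : ℤ) : ℂ) * (2 * Real.pi * I) := by
      push_cast
      linear_combination (2 * Real.pi * I * (m' : ℂ)) * hβC
    rw [e]
    exact Complex.exp_int_mul_two_pi_mul_I _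
  refine ⟨P, fun m' => r (N * m') + ((lam : ℂ) * log ((N * m' : ℕ) : ℂ)) • (fun j => (q j : ℂ)),
    fun m' => Real.log ((N * m' : ℕ) : ℝ), fun m' => 2 * Real.pi * I * ((N * m' : ℕ) : ℂ),
    fun m' => 2 * Real.pi * I * ((N * m' : ℕ) : ℂ) / exp (((Real.log ((N * m' : ℕ) : ℝ) : ℝ)) : ℂ),
    fun m' => exp (eval (r (N * m')) g), ?_, ?_, ?_, ?_, fun m' => ?_, ?_, ?_, ?_⟩
  · -- points of `W ∩ Γ_exp`
    filter_upwards [hmul.eventually hsol] with m' hm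
    refine ⟨pgParam_mem g A _ _ _, pgParam_mem_expGraph_of_solution g A _ fun j => ?_⟩
    rw [hm j, MvPolynomial.eval_toMvPolynomial, Fin.cons_zero]
  · -- the `x`-coordinates
    filter_upwards with m'
    have hcoord : (fun i => P m' (Sum.inl (Fin.castSucc i))) = x (N * m') := by
      funext i; simp [hP]
    rw [hcoord, hx (N * m'), add_smul, add_assoc, add_comm ((2 * Real.pi * I * ((N * m' : ℕ) : ℂ)) • _)]
  · exact (Real.tendsto_log_atTop.comp tendsto_natCast_atTop_atTop).comp hmul
  · -- the transversal part converges
    refine (hr.comp hmul).congr fun m' => ?_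
    simp only [Function.comp_apply]
    rw [← Complex.natCast_log]
    have : ((lam : ℂ) * ((Real.log ((N * m' : ℕ) : ℝ) : ℝ) : ℂ)) • (fun j => (q j : ℂ)) -
        ((Real.log ((N * m' : ℕ) : ℝ) : ℝ) : ℂ) • (fun j => (lam : ℂ) * (q j : ℂ)) = 0 := by
      funext j; simp only [Pi.sub_apply, Pi.smul_apply, smul_eq_mul, Pi.zero_apply]; ring
    rw [add_sub_assoc, this, add_zero]
  · rw [mul_div_cancel₀ _ (Complex.exp_ne_zero _)]
  · -- `Y(m') = 2πi` eventually
    refine tendsto_const_nhds.congr' ?_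
    filter_upwards [eventually_ge_atTop 1] with m' hm
    have hne : ((N * m' : ℕ) : ℂ) ≠ 0 := by
      have : N * m' ≠ 0 := (Nat.mul_pos hN hm).ne'
      exact_mod_cast this
    rw [hexpm m' hm, mul_div_cancel_right₀ _ hne]
  · -- the power coordinate `e^{g(x(Nm'))} = (Nm')^{βλ} e^{g(r(Nm'))}` (no rotation)
    filter_upwards with m'
    have hβc : P m' (Sum.inr (Fin.last (s + 1))) = exp (eval (x (N * m')) g) := by
      simp [hP]
    rw [hβc, hgx (N * m'), mul_add, show (β : ℂ) * ((lam : ℂ) * log ((N * m' : ℕ) : ℂ)) =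
      (((β * lam * Real.log ((N * m' : ℕ) : ℝ) : ℝ)) : ℂ) by rw [← Complex.natCast_log]; push_cast; ring,
      Complex.exp_add, Complex.exp_add, hone, one_mul, mul_comm]
  · -- `C(m') → e^{g(r_p)}`
    exact ((Complex.continuous_exp.comp (MvPolynomial.continuous_eval g)).tendsto _).comp
      (hr.comp hmul)

/-- **Density over an equivariant base with drift `β`, `Nβ ∈ ℤ`, and a transversal ray.**  `deg g ≥ 1`
and a lattice direction `ℓ₀` (all `ℓ₀ⱼ ≠ 0`) with `Re g_D(2πiℓ₀) ≠ 0` make the limit family generic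
(`invariantDirection_limits_generic`). (new)
[cite: MantovaMasser2023, §1 p.5 (the open case dim π(V) = 2 in ℂ³×ℂˣ³)] -/
theorem unprojectedDense_polyFibredGraph_equivariantDirection_rat
    (g : MvPolynomial (Fin (s + 1)) ℂ) (hD : 0 < g.totalDegree) (q : Fin (s + 1) → ℤ) (β : ℝ)
    (N : ℕ) (hN : 0 < N) (k : ℤ) (hβN : (N : ℝ) * β = k)
    (hequiv : ∀ (x : Fin (s + 1) → ℂ) (z : ℂ),
      eval (x + z • fun j => (q j : ℂ)) g = eval x g + (β : ℂ) * z)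
    (ℓ₀ : Fin (s + 1) → ℤ)
    (hℓ₀ : (eval (fun j => 2 * Real.pi * I * (ℓ₀ j : ℂ)) (homogeneousComponent g.totalDegree g)).re ≠ 0)
    (hℓ₀0 : ∀ j, ℓ₀ j ≠ 0)
    (A : Fin (s + 1) → MvPolynomial (Fin (s + 1)) ℂ)
    (hA : ∀ j, eval (fun i => 2 * Real.pi * I * (q i : ℂ))
      (homogeneousComponent (A j).totalDegree (A j)) ≠ 0)
    (lam : ℝ) (hlam : ∀ j, ((A j).totalDegree : ℝ) = lam * (q j : ℝ)) (f : Fin (s + 1) → Polynomial ℂ)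
    (hslow : ∀ j, β * lam + max (β * lam) 0 * ((f j).natDegree : ℝ) < (A j).totalDegree) :
    UnprojectedDense (polyFibredGraph g A (fun j => (f j).toMvPolynomial 0)) :=
  unprojectedDense_polyFibredGraph_equivariantDirection_of_generic g q β N hN k hβN hequiv A hA lam
    hlam f hslow (invariantDirection_limits_generic g hD ℓ₀ hℓ₀ hℓ₀0 _)

/-- **THEOREM (equivariant base, EVERY real drift coefficient, slow regime).**  `g(x + zq) = g(x) + βz`
(`β ∈ ℝ`), `deg g ≥ 1`, a transversal lattice direction `ℓ₀` (all `ℓ₀ⱼ ≠ 0`, `Re g_D(2πiℓ₀) ≠ 0`),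
targets with `(Aⱼ)_{dⱼ}(2πiq) ≠ 0` and `dⱼ = λqⱼ`, fibres with `βλ + max(βλ,0) deg fⱼ < dⱼ` ⟹
`I(W ∩ Γ_exp) = I(W)` (irrational `β`: THEOREM M, the ray is not needed; rational `β`: THEOREM M₂).
(new) [cite: MantovaMasser2023, §1 p.5 (the open case dim π(V) = 2 in ℂ³×ℂˣ³)] -/
theorem unprojectedDense_polyFibredGraph_equivariantDirection_real
    (g : MvPolynomial (Fin (s + 1)) ℂ) (hD : 0 < g.totalDegree) (q : Fin (s + 1) → ℤ) (β : ℝ)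
    (hequiv : ∀ (x : Fin (s + 1) → ℂ) (z : ℂ),
      eval (x + z • fun j => (q j : ℂ)) g = eval x g + (β : ℂ) * z)
    (ℓ₀ : Fin (s + 1) → ℤ)
    (hℓ₀ : (eval (fun j => 2 * Real.pi * I * (ℓ₀ j : ℂ)) (homogeneousComponent g.totalDegree g)).re ≠ 0)
    (hℓ₀0 : ∀ j, ℓ₀ j ≠ 0)
    (A : Fin (s + 1) → MvPolynomial (Fin (s + 1)) ℂ)
    (hA : ∀ j, eval (fun i => 2 * Real.pi * I * (q i : ℂ))
      (homogeneousComponent (A j).totalDegree (A j)) ≠ 0)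
    (lam : ℝ) (hlam : ∀ j, ((A j).totalDegree : ℝ) = lam * (q j : ℝ)) (f : Fin (s + 1) → Polynomial ℂ)
    (hslow : ∀ j, β * lam + max (β * lam) 0 * ((f j).natDegree : ℝ) < (A j).totalDegree) :
    UnprojectedDense (polyFibredGraph g A (fun j => (f j).toMvPolynomial 0)) := by
  by_cases hβ : Irrational β
  · exact unprojectedDense_polyFibredGraph_equivariantDirection g q β hβ hequiv A hA lam hlam f hslow
  · obtain ⟨ρ, hρ⟩ : ∃ ρ : ℚ, (ρ : ℝ) = β := by simpa [Irrational] using hβ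
    refine unprojectedDense_polyFibredGraph_equivariantDirection_rat g hD q β ρ.den ρ.den_pos ρ.num
      ?_ hequiv ℓ₀ hℓ₀ hℓ₀0 A hA lam hlam f hslow
    rw [← hρ, mul_comm]
    exact_mod_cast ρ.mul_den_eq_num

/-- **Certified members with dense exponential points over an equivariant base (every real
drift).**  `A` dominant, `deg g ≥ 2`, the hypotheses of the theorem: all seven hypotheses of
`ECCell (s+2) (s+1)`, not linearly split, `W ∩ Γ_exp ≠ ∅`, `I(W ∩ Γ_exp) = I(W)`. (new)
[cite: MantovaMasser2023, §1 p.5 (the open case dim π(V) = 2 in ℂ³×ℂˣ³)] -/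
theorem polyFibredGraph_equivariantDirection_real_member_dense (g : MvPolynomial (Fin (s + 1)) ℂ)
    (hD : 2 ≤ g.totalDegree) (q : Fin (s + 1) → ℤ) (β : ℝ)
    (hequiv : ∀ (x : Fin (s + 1) → ℂ) (z : ℂ),
      eval (x + z • fun j => (q j : ℂ)) g = eval x g + (β : ℂ) * z)
    (ℓ₀ : Fin (s + 1) → ℤ)
    (hℓ₀ : (eval (fun j => 2 * Real.pi * I * (ℓ₀ j : ℂ)) (homogeneousComponent g.totalDegree g)).re ≠ 0)
    (hℓ₀0 : ∀ j, ℓ₀ j ≠ 0)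
    (A : Fin (s + 1) → MvPolynomial (Fin (s + 1)) ℂ)
    (hAinj : Function.Injective
      (aeval A : MvPolynomial (Fin (s + 1)) ℂ →ₐ[ℂ] MvPolynomial (Fin (s + 1)) ℂ))
    (hA : ∀ j, eval (fun i => 2 * Real.pi * I * (q i : ℂ))
      (homogeneousComponent (A j).totalDegree (A j)) ≠ 0)
    (lam : ℝ) (hlam : ∀ j, ((A j).totalDegree : ℝ) = lam * (q j : ℝ)) (f : Fin (s + 1) → Polynomial ℂ)
    (hslow : ∀ j, β * lam + max (β * lam) 0 * ((f j).natDegree : ℝ) < (A j).totalDegree) :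
    (IsIrreducibleClosed ℂ (polyFibredGraph g A (fun j => (f j).toMvPolynomial 0)) ∧
      (polyFibredGraph g A (fun j => (f j).toMvPolynomial 0) ∩ torusLocus ℂ (s + 2)).Nonempty ∧
      IsRotund ℂ (s + 2) (polyFibredGraph g A (fun j => (f j).toMvPolynomial 0) ∩
        torusLocus ℂ (s + 2)) ∧
      IsAddFree ℂ (s + 2) (polyFibredGraph g A (fun j => (f j).toMvPolynomial 0) ∩
        torusLocus ℂ (s + 2)) ∧
      IsMulFree ℂ (s + 2) (polyFibredGraph g A (fun j => (f j).toMvPolynomial 0) ∩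
        torusLocus ℂ (s + 2)) ∧
      zariskiDim ℂ (polyFibredGraph g A (fun j => (f j).toMvPolynomial 0)) = (s + 2 : ℕ) ∧
      addProjDim ℂ (s + 2) (polyFibredGraph g A (fun j => (f j).toMvPolynomial 0)) = (s + 1 : ℕ)) ∧
    ¬ IsLinearSplit ℂ (s + 2) (polyFibredGraph g A (fun j => (f j).toMvPolynomial 0)) ∧
    (polyFibredGraph g A (fun j => (f j).toMvPolynomial 0) ∩ expGraph ℂ (s + 2)).Nonempty ∧
    UnprojectedDense (polyFibredGraph g A (fun j => (f j).toMvPolynomial 0)) := by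
  have hcell := ecCell_hypotheses_polyFibredGraph g A (fun j => (f j).toMvPolynomial 0) hAinj hD
  have hdense := unprojectedDense_polyFibredGraph_equivariantDirection_real g (by omega) q β hequiv
    ℓ₀ hℓ₀ hℓ₀0 A hA lam hlam f hslow
  refine ⟨hcell, not_isLinearSplit_polyFibredGraph g A _ (Nat.succ_pos s) hAinj, ?_, hdense⟩
  obtain ⟨w, hw, -⟩ := hcell.2.1
  exact inter_expGraph_nonempty_of_vanishingIdeal_eq ⟨w, hw⟩ hdense

end Rational

/-! ## Part B. The example: `x₂ = -(x₀ - x₁)² + x₀/4`, `yⱼ = xⱼ + y₂` (rational drift `1/4`) -/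

section Example

/-- Data of the base `g = -(X₀ - X₁)² + (1/4) X₀`: degree `2`; equivariant under `q = (1,1)` with
RATIONAL drift `β = 1/4`; the transversal direction `ℓ₀ = (1,2)` has `Re g_D(2πiℓ₀) = 4π² ≠ 0`. (new)
[cite: MantovaMasser2023, §1 p.5 (the open case dim π(V) = 2 in ℂ³×ℂˣ³)] -/
theorem negSqDiffQuarter_data :
    (-(X 0 - X 1) ^ 2 + C ((1 / 4 : ℝ) : ℂ) * X 0 : MvPolynomial (Fin 2) ℂ).totalDegree = 2 ∧
    (∀ (x : Fin 2 → ℂ) (z : ℂ), eval (x + z • fun j => ((![1, 1] : Fin 2 → ℤ) j : ℂ))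
        (-(X 0 - X 1) ^ 2 + C ((1 / 4 : ℝ) : ℂ) * X 0 : MvPolynomial (Fin 2) ℂ) =
      eval x (-(X 0 - X 1) ^ 2 + C ((1 / 4 : ℝ) : ℂ) * X 0 : MvPolynomial (Fin 2) ℂ) +
        ((1 / 4 : ℝ) : ℂ) * z) ∧
    homogeneousComponent 2 (-(X 0 - X 1) ^ 2 + C ((1 / 4 : ℝ) : ℂ) * X 0 : MvPolynomial (Fin 2) ℂ) =
      -(X 0 - X 1) ^ 2 ∧
    (eval (fun j => 2 * Real.pi * I * ((![1, 2] : Fin 2 → ℤ) j : ℂ))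
      (-(X 0 - X 1) ^ 2 : MvPolynomial (Fin 2) ℂ)).re = 4 * Real.pi ^ 2 := by
  have hsq : ((X 0 - X 1) ^ 2 : MvPolynomial (Fin 2) ℂ).IsHomogeneous 2 :=
    ((isHomogeneous_X ℂ 0).sub (isHomogeneous_X ℂ 1)).pow 2
  have hsq0 : ((X 0 - X 1) ^ 2 : MvPolynomial (Fin 2) ℂ) ≠ 0 := by
    intro h
    have := congrArg (eval ![1, 0]) h
    simp at this
  have hdeg1 : (C ((1 / 4 : ℝ) : ℂ) * X 0 : MvPolynomial (Fin 2) ℂ).totalDegree ≤ 1 :=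
    (totalDegree_mul _ _).trans (by rw [totalDegree_C, totalDegree_X, zero_add])
  have hcomp : homogeneousComponent 2 (-(X 0 - X 1) ^ 2 + C ((1 / 4 : ℝ) : ℂ) * X 0 :
      MvPolynomial (Fin 2) ℂ) = -(X 0 - X 1) ^ 2 := by
    rw [map_add, homogeneousComponent_of_mem hsq.neg, if_pos rfl,
      homogeneousComponent_eq_zero _ _ (hdeg1.trans_lt (by norm_num)), add_zero]
  refine ⟨?_, fun x z => ?_, hcomp, ?_⟩
  · have hdeg2 : (-(X 0 - X 1) ^ 2 : MvPolynomial (Fin 2) ℂ).totalDegree = 2 := by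
      rw [totalDegree_neg]; exact hsq.totalDegree hsq0
    apply le_antisymm
    · exact (totalDegree_add _ _).trans (max_le hdeg2.le (hdeg1.trans (by norm_num)))
    · by_contra hlt
      push Not at hlt
      have h2 := homogeneousComponent_eq_zero _ _ hlt
      rw [hcomp, neg_eq_zero] at h2
      exact hsq0 h2
  · simp only [map_add, map_neg, map_pow, map_sub, map_mul, eval_C, eval_X, Pi.add_apply,
      Pi.smul_apply, smul_eq_mul, Matrix.cons_val_zero, Matrix.cons_val_one,
      Int.cast_one, mul_one]
    ring
  · have : eval (fun j => 2 * Real.pi * I * ((![1, 2] : Fin 2 → ℤ) j : ℂ))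
        (-(X 0 - X 1) ^ 2 : MvPolynomial (Fin 2) ℂ) = (((4 * Real.pi ^ 2 : ℝ)) : ℂ) := by
      simp only [map_neg, map_pow, map_sub, eval_X, Matrix.cons_val_zero, Matrix.cons_val_one,
        Int.cast_one, Int.cast_ofNat, mul_one]
      push_cast
      have hI : I ^ 2 = -1 := Complex.I_sq
      linear_combination (-(2 * Real.pi : ℂ) ^ 2) * hI
    rw [this, Complex.ofReal_re]

/-- **The rational-drift example is dense.**
`W = {x₂ = -(x₀ - x₁)² + x₀/4, y₀ = x₀ + y₂, y₁ = x₁ + y₂} ⊆ ℂ³ × ℂ³`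
(`e^z = z + e^{-(z-w)² + z/4}`, `e^w = w + e^{-(z-w)² + z/4}`): all seven hypotheses of `ECCell 3 2`,
not linearly split, `W ∩ Γ_exp ≠ ∅` AND `I(W ∩ Γ_exp) = I(W)`. (new)
[cite: MantovaMasser2023, §1 p.5 (the open case dim π(V) = 2 in ℂ³×ℂˣ³)] -/
theorem negSqDiffQuarter_member_dense :
    (IsIrreducibleClosed ℂ (polyFibredGraph
        (-(X 0 - X 1) ^ 2 + C ((1 / 4 : ℝ) : ℂ) * X 0 : MvPolynomial (Fin 2) ℂ)
        (fun j => X j) (fun _ => (1 : Polynomial ℂ).toMvPolynomial 0)) ∧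
      (polyFibredGraph (-(X 0 - X 1) ^ 2 + C ((1 / 4 : ℝ) : ℂ) * X 0 : MvPolynomial (Fin 2) ℂ)
          (fun j => X j) (fun _ => (1 : Polynomial ℂ).toMvPolynomial 0) ∩ torusLocus ℂ 3).Nonempty ∧
      IsRotund ℂ 3 (polyFibredGraph
          (-(X 0 - X 1) ^ 2 + C ((1 / 4 : ℝ) : ℂ) * X 0 : MvPolynomial (Fin 2) ℂ)
          (fun j => X j) (fun _ => (1 : Polynomial ℂ).toMvPolynomial 0) ∩ torusLocus ℂ 3) ∧
      IsAddFree ℂ 3 (polyFibredGraph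
          (-(X 0 - X 1) ^ 2 + C ((1 / 4 : ℝ) : ℂ) * X 0 : MvPolynomial (Fin 2) ℂ)
          (fun j => X j) (fun _ => (1 : Polynomial ℂ).toMvPolynomial 0) ∩ torusLocus ℂ 3) ∧
      IsMulFree ℂ 3 (polyFibredGraph
          (-(X 0 - X 1) ^ 2 + C ((1 / 4 : ℝ) : ℂ) * X 0 : MvPolynomial (Fin 2) ℂ)
          (fun j => X j) (fun _ => (1 : Polynomial ℂ).toMvPolynomial 0) ∩ torusLocus ℂ 3) ∧
      zariskiDim ℂ (polyFibredGraph
          (-(X 0 - X 1) ^ 2 + C ((1 / 4 : ℝ) : ℂ) * X 0 : MvPolynomial (Fin 2) ℂ)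
          (fun j => X j) (fun _ => (1 : Polynomial ℂ).toMvPolynomial 0)) = (3 : ℕ) ∧
      addProjDim ℂ 3 (polyFibredGraph
          (-(X 0 - X 1) ^ 2 + C ((1 / 4 : ℝ) : ℂ) * X 0 : MvPolynomial (Fin 2) ℂ)
          (fun j => X j) (fun _ => (1 : Polynomial ℂ).toMvPolynomial 0)) = (2 : ℕ)) ∧
    ¬ IsLinearSplit ℂ 3 (polyFibredGraph
        (-(X 0 - X 1) ^ 2 + C ((1 / 4 : ℝ) : ℂ) * X 0 : MvPolynomial (Fin 2) ℂ)
        (fun j => X j) (fun _ => (1 : Polynomial ℂ).toMvPolynomial 0)) ∧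
    (polyFibredGraph (-(X 0 - X 1) ^ 2 + C ((1 / 4 : ℝ) : ℂ) * X 0 : MvPolynomial (Fin 2) ℂ)
        (fun j => X j) (fun _ => (1 : Polynomial ℂ).toMvPolynomial 0) ∩ expGraph ℂ 3).Nonempty ∧
    UnprojectedDense (polyFibredGraph
        (-(X 0 - X 1) ^ 2 + C ((1 / 4 : ℝ) : ℂ) * X 0 : MvPolynomial (Fin 2) ℂ)
        (fun j => X j) (fun _ => (1 : Polynomial ℂ).toMvPolynomial 0)) := by
  obtain ⟨hdeg, hequiv, hcomp, hre⟩ := negSqDiffQuarter_data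
  have hAinj : Function.Injective (aeval (fun j : Fin 2 => (X j : MvPolynomial (Fin 2) ℂ)) :
      MvPolynomial (Fin 2) ℂ →ₐ[ℂ] MvPolynomial (Fin 2) ℂ) := by
    rw [aeval_X_left]; exact fun _ _ h => h
  have hlead : ∀ j : Fin 2, homogeneousComponent (X j : MvPolynomial (Fin 2) ℂ).totalDegree
      (X j : MvPolynomial (Fin 2) ℂ) = X j := fun j => by
    rw [totalDegree_X, homogeneousComponent_eq_self (isHomogeneous_X ℂ j)]
  have hA : ∀ j : Fin 2, eval (fun i => 2 * Real.pi * I * ((![1, 1] : Fin 2 → ℤ) i : ℂ))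
      (homogeneousComponent (X j : MvPolynomial (Fin 2) ℂ).totalDegree
        (X j : MvPolynomial (Fin 2) ℂ)) ≠ 0 := by
    intro j
    rw [hlead j, eval_X]
    fin_cases j <;> simp [Real.pi_ne_zero, Complex.I_ne_zero]
  have hlam : ∀ j : Fin 2, ((X j : MvPolynomial (Fin 2) ℂ).totalDegree : ℝ) =
      (1 : ℝ) * (((![1, 1] : Fin 2 → ℤ) j : ℤ) : ℝ) := by
    intro j
    rw [totalDegree_X]
    fin_cases j <;> simp
  have hslow : ∀ j : Fin 2, (1 / 4 : ℝ) * 1 + max ((1 / 4 : ℝ) * 1) 0 *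
      (((fun _ => (1 : Polynomial ℂ)) j).natDegree : ℝ) < (X j : MvPolynomial (Fin 2) ℂ).totalDegree := by
    intro j
    rw [totalDegree_X]
    simp only [Polynomial.natDegree_one, Nat.cast_zero, mul_zero, add_zero, Nat.cast_one, mul_one]
    norm_num
  have hℓ₀ : (eval (fun j => 2 * Real.pi * I * ((![1, 2] : Fin 2 → ℤ) j : ℂ))
      (homogeneousComponent (-(X 0 - X 1) ^ 2 + C ((1 / 4 : ℝ) : ℂ) * X 0 :
        MvPolynomial (Fin 2) ℂ).totalDegree
      (-(X 0 - X 1) ^ 2 + C ((1 / 4 : ℝ) : ℂ) * X 0 : MvPolynomial (Fin 2) ℂ))).re ≠ 0 := by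
    rw [hdeg, hcomp, hre]
    positivity
  have hℓ₀0 : ∀ j : Fin 2, (![1, 2] : Fin 2 → ℤ) j ≠ 0 := by
    intro j; fin_cases j <;> simp
  exact polyFibredGraph_equivariantDirection_real_member_dense _ (by rw [hdeg]) ![1, 1] (1 / 4) hequiv
    ![1, 2] hℓ₀ hℓ₀0 _ hAinj hA 1 hlam (fun _ => 1) hslow

end Example

end Summit.Schanuel.Schanuel.Theorems

end
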